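import Summits.BirchSwinnertonDyer.Rank1Residual.X2.ClassClosureO9RiemannSumCertificate
import Summits.BirchSwinnertonDyer.Rank1Residual.Iwasawa.UnitCoefficientCertificate
import HarnessLib

/-!
# O9 non-split: the `(μ, λ)`-census UNIT-COEFFICIENT certificate `Iwasawa.UnitCoeffAt W p 1` is the
# per-pair Schneider input of `X2.CellCNonsplitGV` (cell `b2b-bsdres`, CLASS-CLOSURE lane, typer
# seat cc-typer-6 gen 9; companion of `X2/ClassClosureO9Certificate.lean` (p251198) and
# `X2/ClassClosureO9RiemannSumCertificate.lean` (p268579))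

HONEST FRAMING (run/shared/lean/b2b/bsd-rank1-residual/, verbatim in every file): prove what is
provable now; shrink each hard class to its core with data; no claim beyond stated classes. The goal
of the cell is to DELETE the COMBINATION-SHAPED residual classes of the Birch–Swinnerton-Dyer formula
for ALL analytic-rank `≤ 1` elliptic curves over `ℚ`, assembled STRICTLY from published theorems, so
that the rank-`≤ 1` remainder becomes exactly the CONSTRUCTION-SHAPED classes, which are TYPED
(missing-input `Prop`s), NOT attempted. This is not "finishing BSD". THEOREMS ONLY (no definition,
no named fact); per-pair certificate CONSUMERS, not a class theorem; nothing is booked; X2c / O9 stays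
CONSTRUCTION-SHAPED; census / instrument output is EVIDENCE, never a Literature fact.

## Why (class-closure O9, experiment type (2)/(4); `class-closure/O9/SUBPARTITION-typed.md`,
## cc-typer-6 gen 9 receipt of 2026-08-21)

On the O9 sub-cell `X2.CellCNonsplitGV W p` (X2c ∧ non-split multiplicative `p` ∧ Greenberg–Vatsal
parity; 1 599 book196 cells) `BSD(E,p)` is COVERED modulo ONE per-pair input, the Schneider
certificate, which p251198 reads as the bit `[T¹]L ≠ 0` for THE non-split Mazur–Tate–Teitelbaum
function (`bsdp_of_cellC_of_not_split_of_gvPar_of_thm1_of_coeff_one_ne_zero`) and p268579 reads in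
Riemann-sum currency. The lane's `(μ, λ)` instruments (cc-eng-6's route K exact orbit-sum fold + PARI
`ellpadiclambdamu`; iw-1's IWASAWA-CENSUS engines A/B) certify per pair, in the vocabulary of iw-1's
`Iwasawa/UnitCoefficientCertificate.lean`, the shape `Iwasawa.UnitCoeffAt W p n`: for every newform
`f` of `W` and every `ϖ` with `ϖ·Ω_E = Ω⁺_f`, the coefficient of index `n` (non-split), resp. `n + 1`
(split), of `ϖ·L` is a `p`-ADIC UNIT. A two-engine reading `(μ, λ) = (0, 1)` at a non-split pair —
the census finds it on 47 of the 57 `CellCNonsplitGV` window cells (RELATIONS-v2.2, 2026-08-21) — is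
`UnitCoeffAt W p 1` once the engines' series is identified with THE function (cc-eng-6's MU-SPEC
normalisation item; the `∀`-newform clause reduces to one newform by strong multiplicity one,
cc-typer-3's `X11b/ClassClosureCertificateNewform.lean`).

**This file proves** that this census certificate IS the O9 non-split input, with no further
hypothesis (no image condition, no Kato divisibility, no regulator):
* `coeff_ne_zero_of_unitCoeffAt_of_not_split` / `coeff_succ_ne_zero_of_unitCoeffAt_of_split` — reading
  a non-vanishing coefficient of THE (non-)split function off the certificate (`ϖ·[Tⁿ]L` a unit ⇒
  `[Tⁿ]L ≠ 0`);
* `schneider_of_unitCoeffAt_one_of_thm1` — at a non-split multiplicative `p ≠ 2` in analytic rank one,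
  `UnitCoeffAt W p 1` ⟹ Schneider non-degeneracy of every §4.2 height datum (via p268579's fixed-datum
  node `schneider_of_coeff_one_ne_zero_of_thm1_of_datum`: Disegni 2020 Thm. 1 non-split, A183 `hD`);
* `bsdp_of_cellC_of_not_split_of_gvPar_of_thm1_of_unitCoeffAt_one` — **`CellCNonsplitGV W p` ∧
  `UnitCoeffAt W p 1` ⟹ `BSDp W p`** from the PUBLISHED named facts of p251198 (A183 `hD`; GV00 at
  `p ‖ N` `hGV`, flag `GV00-mult-asserted`; Wuthrich Thm. 16 `hWu`; Stein–Wuthrich Thm. 6.1 `hJn`,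
  §4.2 existence `hHn`; GZK `hGZK`; modularity `hpar`);
* `bsdp_of_cellC_of_not_split_of_mazurMainConjectureAt_of_thm1_of_unitCoeffAt_one` — the whole
  non-split half of O9 with Mazur's main conjecture at the pair as input (route G per pair on
  `CellCNonsplitNotGV`, `X2/CongruenceTransferRankOne.lean`).
On the SPLIT sub-cells the certificate `UnitCoeffAt W p 1` gives only `[T²]L ≠ 0`
(`coeff_succ_ne_zero_of_unitCoeffAt_of_split`) — the non-vanishing half of the exceptional rank-one
leading term; the residue there is the typed FORMULA `X2.O9.ExceptionalLeadingTermAt` (conditional on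
Schneider), which no coefficient certificate supplies. CONDITIONAL theorems; nothing booked.

References: [Disegni2020] Thm. 1 (§1.2) = Thm. 4 first clause (§3.2); [GreenbergVatsal2000] Thm.
(1.3), pp. 2–4; [SteinWuthrich2013] Thm. 6.1 (p. 20), §3, §4.2, §11 remark (p. 29); [Wuthrich2014]
Thm. 16 (p. 397); [MazurTateTeitelbaum1986Invent] §I.13; HOME/IWASAWA-CENSUS.md §4.4;
`class-closure/relations/README.md` RELATIONS-v2.2; `class-closure/O9/SUBPARTITION-typed.md`.
-/

set_option autoImplicit false

noncomputable section

open scoped Classical MatrixGroups ModularForm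

open CongruenceSubgroup WeierstrassCurve Literature.NumberTheory.EllipticCurves
  Literature.NumberTheory.EllipticCurves.ModularForms
  Literature.NumberTheory.EllipticCurves.Rank1Residual
  Literature.NumberTheory.EllipticCurves.Rank1Residual.Typed
  Literature.NumberTheory.EllipticCurves.GreenbergVatsal2000
  Literature.NumberTheory.EllipticCurves.Wuthrich2014
  Literature.NumberTheory.EllipticCurves.SteinWuthrich2013
  Literature.NumberTheory.EllipticCurves.Disegni2020

namespace Summit.BirchSwinnertonDyer.Rank1Residual.X2

variable (W : WeierstrassCurve ℚ) [W.IsElliptic] [W.IsGloballyMinimal] (p : ℕ) [Fact p.Prime]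

/-! ## §1. Reading a non-vanishing coefficient off the unit-coefficient certificate -/

/-- `‖ϖ • [Tⁿ]L‖ = 1 ⟹ [Tⁿ]L ≠ 0`. [folklore] -/
theorem coeff_ne_zero_of_norm_coeff_C_mul_eq_one {ϖ : ℚ_[p]} {L : PowerSeries ℚ_[p]} {n : ℕ}
    (h : ‖PowerSeries.coeff n (PowerSeries.C ϖ * L)‖ = 1) : PowerSeries.coeff n L ≠ 0 := by
  intro h0
  rw [PowerSeries.coeff_C_mul, h0, mul_zero, norm_zero] at h
  exact zero_ne_one h

variable {W p}

omit [W.IsElliptic] [W.IsGloballyMinimal] in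
/-- **Non-split clause of the certificate**: `UnitCoeffAt W p n` at a non-split `p` gives `[Tⁿ]L ≠ 0`
for THE non-split function `L` of any newform `f` of `W` admitting a rational period ratio `ϖ`
(`ϖ·Ω_E = Ω⁺_f`). [cite: GreenbergVatsal2000, p. 2–3, (2) (shape only; nothing asserted)] -/
theorem coeff_ne_zero_of_unitCoeffAt_of_not_split {n : ℕ} (hcert : Iwasawa.UnitCoeffAt W p n)
    (hns : ¬ W.HasSplitMultiplicativeReductionAtPrime p)
    {N : ℕ} [NeZero N] {f : CuspForm (Gamma0 N) 2} (hf : IsNewformOf W f)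
    {ϖ : ℚ} (hϖ : (ϖ : ℝ) * W.realPeriodRat = plusPeriod f)
    {L : PowerSeries ℚ_[p]} (hL : IsMultPAdicLFunctionOf f p (-1) L) :
    PowerSeries.coeff n L ≠ 0 :=
  coeff_ne_zero_of_norm_coeff_C_mul_eq_one p ((hcert f hf ϖ hϖ).1 hns L hL)

omit [W.IsElliptic] [W.IsGloballyMinimal] in
/-- **Split clause of the certificate**: `UnitCoeffAt W p n` at a split `p` gives `[Tⁿ⁺¹]L ≠ 0` for
THE split function (the trivial zero shifts the index). On O9's split sub-cells this is the
non-vanishing HALF of the exceptional leading term only; the formula `X2.O9.ExceptionalLeadingTermAt`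
is untouched. [cite: GreenbergVatsal2000, p. 2–3, (2) (shape only; nothing asserted)] -/
theorem coeff_succ_ne_zero_of_unitCoeffAt_of_split {n : ℕ} (hcert : Iwasawa.UnitCoeffAt W p n)
    (hsplit : W.HasSplitMultiplicativeReductionAtPrime p)
    {N : ℕ} [NeZero N] {f : CuspForm (Gamma0 N) 2} (hf : IsNewformOf W f)
    {ϖ : ℚ} (hϖ : (ϖ : ℝ) * W.realPeriodRat = plusPeriod f)
    {L : PowerSeries ℚ_[p]} (hL : IsSplitMultPAdicLFunctionOf f p L) :
    PowerSeries.coeff (n + 1) L ≠ 0 :=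
  coeff_ne_zero_of_norm_coeff_C_mul_eq_one p ((hcert f hf ϖ hϖ).2 hsplit L hL)

variable (W p)

/-! ## §2. Non-split O9: the certificate is the Schneider input -/

/-- **`UnitCoeffAt W p 1` ⟹ Schneider**, at a non-split multiplicative `p ≠ 2` in analytic rank one:
instantiate the certificate at the modular parametrisation datum (`hpar`: newform `Dm.f`, period
ratio `ϖ > 0`) to get `[T¹]L ≠ 0` for THE non-split function, then p268579's fixed-datum node
(Disegni's non-split identity A183, `hD`). No image hypothesis, no regulator computed.
[cite: Disegni2020, Thm. 1 (§1.2) = Thm. 4 first bullet (§3.2)] [cite: SteinWuthrich2013, §4.2]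
[cite: MazurTateTeitelbaum1986Invent, §I.13] -/
theorem schneider_of_unitCoeffAt_one_of_thm1 (hD : thm1_padicBSD_rankOne_multiplicative)
    (hpar : nonempty_modularParametrizationData) (hp2 : p ≠ 2)
    (hmult : W.HasMultiplicativeReductionAtPrime p) (hns : ¬ W.HasSplitMultiplicativeReductionAtPrime p)
    (hr1 : W.analyticRank = 1) (hcert : Iwasawa.UnitCoeffAt W p 1)
    {q : ℚ_[p]} (hq0 : q ≠ 0) (hq1 : ‖q‖ < 1) (hqj : tateJ q = (W.j : ℚ_[p]))
    (Dh : PAdicHeightData W p) (hDh : IsMultCanonical Dh q) : SchneiderConjecture Dh := by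
  haveI : NeZero (W.conductorNorm ℤ) := ⟨(W.conductorNorm_pos_holds).ne'⟩
  obtain ⟨Dm⟩ := hpar W
  obtain ⟨ϖ, -, hϖ, -⟩ := Dm.exists_rat_mul_realPeriodRat_eq_plusPeriod
  exact schneider_of_coeff_one_ne_zero_of_thm1_of_datum W p hD Dm hp2 hmult hns hr1
    (fun _ hL ↦ coeff_ne_zero_of_unitCoeffAt_of_not_split hcert hns Dm.isNewformOf hϖ hL)
    hq0 hq1 hqj Dh hDh

/-- **Sub-cell `X2.CellCNonsplitGV` ∧ `UnitCoeffAt W p 1` ⟹ `BSD(E,p)`** — p251198's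
`bsdp_of_cellC_of_not_split_of_gvPar_of_thm1_of_schneider` with its per-pair Schneider binder
DISCHARGED by the `(μ, λ)`-census certificate (`schneider_of_unitCoeffAt_one_of_thm1`). PUBLISHED
named facts only (A183 `hD`; GV00 at `p ‖ N` `hGV`, flag `GV00-mult-asserted`; Wuthrich Thm. 16 `hWu`;
SW Thm. 6.1 `hJn`, §4.2 existence `hHn`; GZK; modularity) + ONE per-pair certificate `hcert` (a
two-engine `(μ, λ) = (0, 1)` reading of THE non-split function: 47 of the 57 window cells of the
sub-cell in RELATIONS-v2.2 — EVIDENCE; the identification of the engines' series with THE function is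
the instrument owner's MU-SPEC item). CONDITIONAL; nothing booked; X2c stays CONSTRUCTION-SHAPED.
[cite: Disegni2020, Thm. 1 (§1.2)] [cite: GreenbergVatsal2000, Thm. (1.3) with pp. 1, 14–15]
[cite: Wuthrich2014, Thm. 16 (p. 397)] [cite: SteinWuthrich2013, Thm. 6.1 (p. 20), §4.2, §11 remark (p. 29)] -/
theorem bsdp_of_cellC_of_not_split_of_gvPar_of_thm1_of_unitCoeffAt_one
    (hD : thm1_padicBSD_rankOne_multiplicative) (hGV : lambdaMu_multiplicative_of_gvPar)
    (hWu : thm16_charIdeal_dvd_multiplicative_of_reducible) (hJn : thm61_nonsplitMultiplicative)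
    (hHn : exists_isMultCanonical) (hGZK : rank_eq_analyticRank_of_analyticRank_le_one)
    (hpar : nonempty_modularParametrizationData) (hc : CellCNonsplitGV W p)
    (hcert : Iwasawa.UnitCoeffAt W p 1) : BSDp W p :=
  bsdp_of_cellC_of_not_split_of_gvPar_of_thm1_of_schneider W p hD hGV hWu hJn hHn hGZK hpar hc
    (fun _ Dh hq0 hq1 hqj hDh ↦ schneider_of_unitCoeffAt_one_of_thm1 W p hD hpar hc.1.2.1
      hc.1.2.2.2 hc.2.1 hc.1.1 hcert hq0 hq1 hqj Dh hDh)

/-- **X2c ∧ ¬split ∧ Mazur's MC at the pair ∧ `UnitCoeffAt W p 1` ⟹ `BSD(E,p)`** — the whole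
non-split half of O9 with the census certificate in place of the Schneider binder (the MC at the
pair is PUBLISHED on the gvpar sub-cell, above, and per pair by route G on `CellCNonsplitNotGV`,
`X2/CongruenceTransferRankOne.lean` — whose own `(μ, λ)` target half is the same census row).
CONDITIONAL; nothing booked. [cite: Disegni2020, Thm. 1 (§1.2)]
[cite: SteinWuthrich2013, Thm. 6.1 (p. 20), §4.2] -/
theorem bsdp_of_cellC_of_not_split_of_mazurMainConjectureAt_of_thm1_of_unitCoeffAt_one
    (hD : thm1_padicBSD_rankOne_multiplicative) (hJn : thm61_nonsplitMultiplicative)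
    (hHn : exists_isMultCanonical) (hGZK : rank_eq_analyticRank_of_analyticRank_le_one)
    (hpar : nonempty_modularParametrizationData)
    (hc : CellC W p) (hns : ¬ W.HasSplitMultiplicativeReductionAtPrime p)
    (hMC : MazurMainConjectureAt W p) (hcert : Iwasawa.UnitCoeffAt W p 1) : BSDp W p :=
  bsdp_of_cellC_of_not_split_of_mazurMainConjectureAt_of_thm1_of_schneider W p hD hJn hHn hGZK hpar
    hc hns hMC
    (fun _ Dh hq0 hq1 hqj hDh ↦ schneider_of_unitCoeffAt_one_of_thm1 W p hD hpar hc.2.1 hc.2.2.2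
      hns hc.1 hcert hq0 hq1 hqj Dh hDh)

/-- **By-product: the certificate also gives x11a's `μ_an(E,p) = 0` shape** at the pair (iw-1's
`Iwasawa.muAnZeroAt_of_unitCoeffAt`, restated here so O9 consumers import one file). [folklore] -/
theorem muAnZeroAt_of_unitCoeffAt_one (hcert : Iwasawa.UnitCoeffAt W p 1) : X11a.MuAnZeroAt W p :=
  Iwasawa.muAnZeroAt_of_unitCoeffAt hcert

end Summit.BirchSwinnertonDyer.Rank1Residual.X2

end
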